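import Summits.CriticalPhenomena.PercolationContinuityZ3.Theorems.Transplant.FKConnectivityAllQForestNearTightEars
import HarnessLib

/-!
# THE EARS THEOREM: the square-free adjacent forest Rayleigh inequality across every near-tight gadget with two ears

Support file (`--supports stmt-CriticalPhenomena-4575`), FK sub-lane `prim-bschramm-fk-1` (gen 22) of the post-continuity programme;
builds on p205010 (kernel theorem, internal audit signed; external expert review pending).  No definitions, no named facts, no sorries;
standard axioms.  Part 2 of 2 (part 1: `…ForestNearTightEars`; tools: `…ForestNearTight`).

THE NODE (`AdjForestRayleighNoSqOn`): `#(Fo ∩ {e, f ∈ ω}, Fo) ≤ #(Fo ∩ {e ∈ ω}, Fo ∩ {f ∈ ω})` on a fibre `(M, u₀)` — the pairs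
`e = ov`, `f = oy` are negatively correlated in the uniform ordered two-forest partition `(A, B)` of a finite multigraph.
**`adjForestNoSq_fibre_of_ears`** proves it on every fibre carrying a NEAR-TIGHT GADGET WITH TWO EARS (setting of part 1: free inside
pairs `E ⊆ M` inside `U`, `2|U| ≤ |E| + 3`, `e, f ∈ E`, the `E`-pairs at `v` are `e, r = vv'`, those at `y` are `f, t = y'y`).
PROOF = the TWO-TOGGLE RULE (memo bschramm/FROM-fk-1-g21-SIGMA-EXCHANGE.md §3c) as one `σ`-equivariant injection
`Bad → Good₁ ⊔ Good₂`: a bad pair goes by `ι' = (A − e + r, B − r + e)` followed by the class swap when `ι'` is valid, and by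
`ι = (A − f + t, B − t + f)` otherwise (valid by `ears_iota_valid`); both are exchange injections (`fibreCount_exchange_le_of`), and
their images are separated by the fibre event `P` = "`t ∈ C`, the `ι`-preimage `C − t + f` is a forest, and `ι'` is invalid at that
preimage" — `ι`-images lie in `P` (`ears_iota_image_mem`), swapped `ι'`-images do not (`ears_swap_image_not_mem`: a coincidence
would close a cycle through `e` or `f`, Lemmas X′/Y′ of the seat notes).  Adding the two injections over the split
`Good₁ = (Good₁ ∩ P) ⊔ (Good₁ ∩ Pᶜ)` gives `Bad ≤ Good₁`.
COROLLARIES (`…ForestAdjacentFan`): fans of every length (`v, y` joined by a path of neighbours of `o`), hence the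
LOCALLY-CONNECTED THEOREM.  Not in print as searched (seat notes: presearch); Semple–Welsh prove the all-pairs statement exactly for
graphs without `K₄` minor.
[cite: SempleWelsh2008, Conj. 1.1 (p. 2); Thm. 4.2 (p. 11)] [cite: Linusson2011, Prop. 2.6] [cite: Grimmett2006, §1.5 (p. 13)]
-/

noncomputable section

namespace Summit.CriticalPhenomena.PercolationContinuityZ3.Theorems
namespace FK

open Set Literature.Probability.LatticeModels Literature.Probability.Percolation
open scoped Classical symmDiff

variable {V : Type*} [Fintype V]

section EarsMain

variable {M u₀ : BondConfig V} {U : Finset V} {E : Finset (Sym2 V)} {o v v' y' y : V}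

variable (hEM : ∀ g ∈ E, g ∈ M) (hEU : ∀ g ∈ E, ∀ w ∈ g, w ∈ U) (hcard : 2 * U.card ≤ E.card + 3)
  (heE : s(o, v) ∈ E) (hfE : s(o, y) ∈ E) (hrE : s(v, v') ∈ E) (htE : s(y', y) ∈ E)
  (hve : ∀ g ∈ E, v ∈ g → g = s(o, v) ∨ g = s(v, v')) (hye : ∀ g ∈ E, y ∈ g → g = s(o, y) ∨ g = s(y', y))
  (hov : o ≠ v) (hoy : o ≠ y) (hvy : v ≠ y) (hvv' : v ≠ v') (hyy' : y ≠ y') (hv'y : v' ≠ y) (hvy' : v ≠ y')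
include hEM hEU hcard heE hfE hrE htE hve hye hov hoy hvy hvv' hyy' hv'y hvy'

omit hEU hcard heE hrE hve hye hoy hvv' hyy' hv'y in
/-- **`ι`-images lie in the separating event `P`**: if `ω` is a forest through `e, f` missing `t` at which `ι'` is invalid, then
`C = ω − f + t` satisfies: `t ∈ C`, `C − t + f (= ω)` is a forest, and `ι'` is invalid at `(C − t + f, its partner)`.
[cite: Linusson2011, Prop. 2.6] -/
theorem ears_iota_image_mem {ω : BondConfig V} (hA : IsForestCfg ω) (hf : s(o, y) ∈ ω) (ht : s(y', y) ∉ ω)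
    (hinv : ¬ (s(v, v') ∉ ω ∧ ¬ (openGraph (ω \ {s(o, v)})).Reachable v v' ∧
      ¬ (openGraph ((ω ∆ M) \ {s(v, v')})).Reachable o v)) :
    insert s(y', y) (ω \ {s(o, y)}) ∈
      {C : BondConfig V | s(y', y) ∈ C ∧ IsForestCfg (insert s(o, y) (C \ {s(y', y)})) ∧
        (s(v, v') ∈ C ∨ (openGraph (insert s(o, y) (C \ {s(y', y)}) \ {s(o, v)})).Reachable v v' ∨
          (openGraph (insert s(y', y) ((C ∆ M) \ {s(o, y)}) \ {s(v, v')})).Reachable o v)} := by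
  have hfM : s(o, y) ∈ M := hEM _ hfE
  have htM : s(y', y) ∈ M := hEM _ htE
  have htB : s(y', y) ∈ ω ∆ M := (mem_symmDiff_iff_not_mem htM).2 ht
  have hfB : s(o, y) ∉ ω ∆ M := fun h => (mem_symmDiff_iff_not_mem hfM).1 h hf
  have hrt : s(v, v') ≠ s(y', y) := ears_r_ne_t (v' := v') (y' := y') hvy hvy'
  have hrf : s(v, v') ≠ s(o, y) := fun h => by
    rcases Sym2.eq_iff.1 h with ⟨h1, _⟩ | ⟨h1, _⟩
    · exact hov h1.symm
    · exact hvy h1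
  have h1 : insert s(o, y) (insert s(y', y) (ω \ {s(o, y)}) \ {s(y', y)}) = ω := insert_sdiff_insert_sdiff_cancel hf ht
  have h2 : insert s(y', y) (ω \ {s(o, y)}) ∆ M = insert s(o, y) ((ω ∆ M) \ {s(y', y)}) :=
    insert_sdiff_singleton_symmDiff hfM htM hf ht
  have h3 : insert s(y', y) (insert s(o, y) ((ω ∆ M) \ {s(y', y)}) \ {s(o, y)}) = ω ∆ M :=
    insert_sdiff_insert_sdiff_cancel htB hfB
  refine ⟨mem_insert _ _, by rw [h1]; exact hA, ?_⟩
  rw [h1, h2, h3]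
  by_cases hr : s(v, v') ∈ ω
  · exact Or.inl (mem_insert_of_mem _ ⟨hr, hrf⟩)
  · by_cases hR : (openGraph (ω \ {s(o, v)})).Reachable v v'
    · exact Or.inr (Or.inl hR)
    · refine Or.inr (Or.inr ?_)
      by_contra hc
      exact hinv ⟨hr, hR, hc⟩

omit [Fintype V] hEU hcard hve hye hyy' hv'y in
/-- **Swapped `ι'`-images avoid `P`** (σ-freeness of the two-toggle rule): if `(ω, ω ∆ M)` is a bad pair of forests at which `ι'`
is valid (`r ∉ ω`, `v ↮ v'` in `ω − e`, `o ↮ v` in `(ω ∆ M) − r`), then the swapped image `C = (ω ∆ M) − r + e` is not in `P`: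
otherwise `t ∈ C`, the `ι`-preimage `C − t + f = (ω ∆ M) − r − t + e + f` is a forest, and either `v ~ v'` in `C − t + f − e`
(three cases along `f`: a cycle through `r` in `ω ∆ M`, or `o ~ v` off `r`, or the cycle `o e v … y f o`) or `o ~ v` in
`ω − e − f + t` (three cases along `t`: cycles through `e` or `f` in `ω`). [cite: Grimmett2006, §1.5 (p. 13)] [cite: Linusson2011, Prop. 2.6] -/
theorem ears_swap_image_not_mem {ω : BondConfig V} (hA : IsForestCfg ω) (hB : IsForestCfg (ω ∆ M)) (he : s(o, v) ∈ ω)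
    (hf : s(o, y) ∈ ω) (hr : s(v, v') ∉ ω) (hval : ¬ (openGraph ((ω ∆ M) \ {s(v, v')})).Reachable o v) :
    insert s(o, v) ((ω ∆ M) \ {s(v, v')}) ∉
      {C : BondConfig V | s(y', y) ∈ C ∧ IsForestCfg (insert s(o, y) (C \ {s(y', y)})) ∧
        (s(v, v') ∈ C ∨ (openGraph (insert s(o, y) (C \ {s(y', y)}) \ {s(o, v)})).Reachable v v' ∨
          (openGraph (insert s(y', y) ((C ∆ M) \ {s(o, y)}) \ {s(v, v')})).Reachable o v)} := by
  rintro ⟨htC, hA₁, hdisj⟩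
  have heM : s(o, v) ∈ M := hEM _ heE
  have hfM : s(o, y) ∈ M := hEM _ hfE
  have hrM : s(v, v') ∈ M := hEM _ hrE
  have htM : s(y', y) ∈ M := hEM _ htE
  have hrB : s(v, v') ∈ ω ∆ M := (mem_symmDiff_iff_not_mem hrM).2 hr
  have heB : s(o, v) ∉ ω ∆ M := fun h => (mem_symmDiff_iff_not_mem heM).1 h he
  have hrt : s(v, v') ≠ s(y', y) := ears_r_ne_t (v' := v') (y' := y') hvy hvy'
  have hef : s(o, v) ≠ s(o, y) := fun h' => hvy (Sym2.congr_right.1 h')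
  have het : s(o, v) ≠ s(y', y) := fun h => by
    rcases Sym2.eq_iff.1 h with ⟨_, h1⟩ | ⟨h1, _⟩
    · exact hvy h1
    · exact hoy h1
  have hrf : s(v, v') ≠ s(o, y) := fun h => by
    rcases Sym2.eq_iff.1 h with ⟨h1, _⟩ | ⟨h1, _⟩
    · exact hov h1.symm
    · exact hvy h1
  -- no cycle through a present pair
  have hcyc : ∀ {X : BondConfig V} {a b : V}, IsForestCfg X → a ≠ b → s(a, b) ∈ X →
      ¬ (openGraph (X \ {s(a, b)})).Reachable a b := fun {X a b} hX hab hz => by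
    have hX' : IsForestCfg (insert s(a, b) (X \ {s(a, b)})) := by rwa [insert_sdiff_self_of_mem hz]
    exact ((isForestCfg_insert_iff hab fun h' => h'.2 rfl).1 hX').2
  -- `t ∈ C` means `t ∈ B`, so `t ∉ A`
  have htB : s(y', y) ∈ ω ∆ M := by
    rcases (mem_insert_iff.1 htC) with h | h
    · exact absurd h.symm het
    · exact h.1
  have ht : s(y', y) ∉ ω := (mem_symmDiff_iff_not_mem htM).1 htB
  -- the three set identities
  set W : BondConfig V := ((ω ∆ M) \ {s(v, v')}) \ {s(y', y)} with hW
  have heW : s(o, v) ∉ insert s(o, y) W := by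
    rintro (h | h)
    · exact hef h
    · exact heB h.1.1
  have hS2 : insert s(o, y) (insert s(o, v) ((ω ∆ M) \ {s(v, v')}) \ {s(y', y)}) = insert s(o, v) (insert s(o, y) W) := by
    rw [hW, ← insert_sdiff_singleton_comm het, insert_comm]
  have hS1 : insert s(o, y) (insert s(o, v) ((ω ∆ M) \ {s(v, v')}) \ {s(y', y)}) \ {s(o, v)} = insert s(o, y) W := by
    rw [hS2, insert_sdiff_self_of_notMem heW]
  set W₂ : BondConfig V := (ω \ {s(o, v)}) \ {s(o, y)} with hW₂
  have hrW₂ : s(v, v') ∉ W₂ := fun h => hr h.1.1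
  have hS3 : insert s(y', y) ((insert s(o, v) ((ω ∆ M) \ {s(v, v')}) ∆ M) \ {s(o, y)}) \ {s(v, v')} = insert s(y', y) W₂ := by
    have h0 : insert s(o, v) ((ω ∆ M) \ {s(v, v')}) ∆ M = insert s(v, v') (ω \ {s(o, v)}) := by
      rw [← insert_sdiff_singleton_symmDiff heM hrM he hr, symmDiff_symmDiff_cancel_right]
    rw [h0, ← insert_sdiff_singleton_comm hrf, ← hW₂, ← insert_sdiff_singleton_comm hrt.symm, insert_sdiff_self_of_notMem hrW₂]
  rw [hS1, hS3] at hdisj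
  rw [hS2] at hA₁
  have hWsub : W ⊆ (ω ∆ M) \ {s(v, v')} := sdiff_subset
  rcases hdisj with h | h | h
  · -- `r ∈ C`: impossible
    rcases mem_insert_iff.1 h with h | h
    · exact hr (by rw [h]; exact he)
    · exact h.2 rfl
  · -- Lemma X′: `v ~ v'` in `f + W`
    rw [KNSep.reachable_insert_iff] at h
    rcases h with h | ⟨h, -⟩ | ⟨h, -⟩
    · exact hcyc hB hvv' hrB (h.mono (openGraph_mono hWsub))
    · exact hval (h.mono (openGraph_mono hWsub)).symm
    · -- `o —e— v ~ y —f— o` inside the forest `e + f + W`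
      have hcyc' := ((isForestCfg_insert_iff hov heW).1 hA₁).2
      refine hcyc' ((reach_of_mem (mem_insert _ _) hoy).trans ?_)
      exact (h.mono (openGraph_mono (subset_insert _ _))).symm
  · -- Lemma Y′: `o ~ v` in `t + W₂`
    rw [KNSep.reachable_insert_iff] at h
    have hW₂e : W₂ ⊆ ω \ {s(o, v)} := sdiff_subset
    have hW₂f : W₂ ⊆ ω \ {s(o, y)} := by rw [hW₂, Set.sdiff_sdiff_comm]; exact sdiff_subset
    rcases h with h | ⟨-, h⟩ | ⟨h, -⟩
    · exact hcyc hA hov he (h.mono (openGraph_mono hW₂e))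
    · exact hcyc hA hov he ((reach_of_mem_sdiff hf hoy hef.symm).trans (h.mono (openGraph_mono hW₂e)))
    · exact hcyc hA hoy hf (h.mono (openGraph_mono hW₂f))

/-- **THE EARS THEOREM.**  On every fibre `(M, u₀)` carrying a near-tight gadget with two ears — free inside pairs `E ⊆ M` with
ends in the finite vertex set `U`, `2|U| ≤ |E| + 3`, `e = ov, f = oy ∈ E`, the `E`-pairs at `v` exactly `e` and `r = vv'`, the
`E`-pairs at `y` exactly `f` and `t = y'y`, with `o, v, v'` distinct, `o ≠ y ≠ y'`, `v ≠ y`, `v' ≠ y`, `v ≠ y'` — the square-free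
adjacent forest Rayleigh inequality holds: `#(Fo ∩ {e, f ∈ ω}, Fo) ≤ #(Fo ∩ {e ∈ ω}, Fo ∩ {f ∈ ω})`.  In words: in the uniform
ordered two-forest partition of a finite multigraph, `ov` and `oy` are negatively correlated as soon as `v` and `y` are ears
(inside degree two) of a near-tight set of free pairs through `ov, oy` — e.g. the ends of a path of neighbours of `o` (fans:
`…ForestAdjacentFan`), or degree-two vertices of any Laman graph through `o`.  Proof: the two-toggle rule, see the file header.
[cite: SempleWelsh2008, Conj. 1.1 (p. 2); Thm. 4.2 (p. 11)] [cite: Linusson2011, Prop. 2.6] [cite: Grimmett2006, §1.5 (p. 13)] -/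
theorem adjForestNoSq_fibre_of_ears :
    fibreCount M u₀ (forestEv V ∩ {ω | s(o, v) ∈ ω ∧ s(o, y) ∈ ω}) (forestEv V) ≤
      fibreCount M u₀ (forestEv V ∩ {ω | s(o, v) ∈ ω}) (forestEv V ∩ {ω | s(o, y) ∈ ω}) := by
  have heM : s(o, v) ∈ M := hEM _ heE
  have hfM : s(o, y) ∈ M := hEM _ hfE
  have hrM : s(v, v') ∈ M := hEM _ hrE
  have htM : s(y', y) ∈ M := hEM _ htE
  have hef : s(o, v) ≠ s(o, y) := fun h' => hvy (Sym2.congr_right.1 h')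
  -- the separating event and the validity event
  set P : Set (BondConfig V) := {C : BondConfig V | s(y', y) ∈ C ∧ IsForestCfg (insert s(o, y) (C \ {s(y', y)})) ∧
    (s(v, v') ∈ C ∨ (openGraph (insert s(o, y) (C \ {s(y', y)}) \ {s(o, v)})).Reachable v v' ∨
      (openGraph (insert s(y', y) ((C ∆ M) \ {s(o, y)}) \ {s(v, v')})).Reachable o v)} with hP
  set Val : Set (BondConfig V) := {ω : BondConfig V | s(v, v') ∉ ω ∧ ¬ (openGraph (ω \ {s(o, v)})).Reachable v v' ∧
    ¬ (openGraph ((ω ∆ M) \ {s(v, v')})).Reachable o v} with hVal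
  have s1 := fibreCount_split_pred M u₀ (forestEv V ∩ {ω | s(o, v) ∈ ω ∧ s(o, y) ∈ ω}) (forestEv V) Val
  have t1 := fibreCount_split_pred M u₀ (forestEv V ∩ {ω | s(o, v) ∈ ω}) (forestEv V ∩ {ω | s(o, y) ∈ ω}) P
  -- valid: `ι'` then the class swap, landing outside `P`
  have h1 : fibreCount M u₀ (forestEv V ∩ {ω | s(o, v) ∈ ω ∧ s(o, y) ∈ ω} ∩ Val) (forestEv V) ≤
      fibreCount M u₀ (forestEv V ∩ {ω | s(o, v) ∈ ω} ∩ Pᶜ) (forestEv V ∩ {ω | s(o, y) ∈ ω}) := by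
    refine le_trans (fibreCount_exchange_le_of heM hrM (A' := forestEv V ∩ {ω | s(o, y) ∈ ω})
      (B' := forestEv V ∩ {ω | s(o, v) ∈ ω} ∩ Pᶜ) fun ω _ hA hB => ?_) (le_of_eq (fibreCount_swap _ _ _ _))
    obtain ⟨⟨hF, he, hf⟩, hr, hR1, hR2⟩ := hA
    have hF' : IsForestCfg (ω ∆ M) := hB
    have heB : s(o, v) ∉ (ω ∆ M) \ {s(v, v')} := fun h => (mem_symmDiff_iff_not_mem heM).1 h.1 he
    refine ⟨he, hr, ⟨?_, mem_insert_of_mem _ ⟨hf, hef.symm⟩⟩, ⟨?_, mem_insert _ _⟩, ?_⟩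
    · exact (isForestCfg_insert_iff hvv' fun h => hr h.1).2 ⟨isForestCfg_of_subset hF sdiff_subset, hR1⟩
    · exact (isForestCfg_insert_iff hov heB).2 ⟨isForestCfg_of_subset hF' sdiff_subset, hR2⟩
    · exact ears_swap_image_not_mem hEM heE hfE hrE htE hov hoy hvy hvv' hvy' hF hF' he hf hr hR2
  -- invalid: `ι`, landing inside `P`
  have h2 : fibreCount M u₀ (forestEv V ∩ {ω | s(o, v) ∈ ω ∧ s(o, y) ∈ ω} ∩ Valᶜ) (forestEv V) ≤
      fibreCount M u₀ (forestEv V ∩ {ω | s(o, v) ∈ ω} ∩ P) (forestEv V ∩ {ω | s(o, y) ∈ ω}) := by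
    refine fibreCount_exchange_le_of hfM htM fun ω _ hA hB => ?_
    obtain ⟨⟨hF, he, hf⟩, hinv⟩ := hA
    have hF' : IsForestCfg (ω ∆ M) := hB
    obtain ⟨ht, hR1, hR2⟩ :=
      ears_iota_valid hEM hEU hcard heE hfE hrE htE hve hye hov hoy hvy hvv' hyy' hv'y hvy' hF hF' he hf hinv
    have hfB : s(o, y) ∉ (ω ∆ M) \ {s(y', y)} := fun h => (mem_symmDiff_iff_not_mem hfM).1 h.1 hf
    refine ⟨hf, ht, ⟨⟨?_, mem_insert_of_mem _ ⟨he, hef⟩⟩, ?_⟩, ?_, mem_insert _ _⟩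
    · exact (isForestCfg_insert_iff hyy'.symm fun h => ht h.1).2 ⟨isForestCfg_of_subset hF sdiff_subset, hR1⟩
    · exact ears_iota_image_mem hEM hfE htE hov hvy hvy' hF hf ht hinv
    · exact (isForestCfg_insert_iff hoy hfB).2 ⟨isForestCfg_of_subset hF' sdiff_subset, hR2⟩
  omega

/-- **Top-fibre form** (simple graphs): for a finite graph with pair set `Eg ⊇ E` carrying the gadget, the number of ordered
two-forest partitions `(A, Eg ∖ A)` with `ov, oy ∈ A` is at most the number with `ov ∈ A`, `oy ∉ A`.
[cite: SempleWelsh2008, Conj. 1.1 (p. 2)] [cite: Linusson2011, Prop. 2.6] -/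
theorem adjForestNoSq_top_of_ears :
    fibreCount M ∅ (forestEv V ∩ {ω | s(o, v) ∈ ω ∧ s(o, y) ∈ ω}) (forestEv V) ≤
      fibreCount M ∅ (forestEv V ∩ {ω | s(o, v) ∈ ω}) (forestEv V ∩ {ω | s(o, y) ∈ ω}) :=
  adjForestNoSq_fibre_of_ears hEM hEU hcard heE hfE hrE htE hve hye hov hoy hvy hvv' hyy' hv'y hvy'

end EarsMain

end FK
end Summit.CriticalPhenomena.PercolationContinuityZ3.Theorems

end
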